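import Summits.QuantumFields.QCD.Theorems.PauliWegnerSeaFMClosureUnquenchedSideWitnessC1Aux5
import Summits.QuantumFields.QCD.Theorems.PauliWegnerSeaFMClosureUnquenchedSideWitnessC1Aux6

/-!
# Side witness, part 8: the flow on the complement of a corner box

Crux `FMClosureUnquenched` (stmt-QuantumFields-11512), line `von-mises-circles`, registered sub-goal
`c1_sideWitness : SideWitness`.

Let `A = {y | ∃ i, q ≤ OFF c y i}` be the complement of the corner box `[0, q)⁴` (corner `c`) in the
torus of side `2S+1`, `I = [0, q)`, `J = [q, 2S]`.  The flow on `A`: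
* rule `R0`: `y → y + e₀` whenever a coordinate `1, 2, 3` of `y` lies in `J` (the `0`-circle through
  `y` stays in `A`); rule `R1`: `y → y + e₁` whenever a coordinate `0, 2, 3` lies in `J`;
* the *deficit* sites (coordinates `2, 3 ∈ I` and exactly one of `0, 1` in `J`) get one
  supplementary out-edge and in-edge from an abstract system `SL0/SEL0` (class: coordinate `0 ∈ J`) resp.
  `SL1/SEL1` (coordinate `1 ∈ J`) which keeps the class, is undone by the reversed in-label, avoids
  direction `1` resp. `0`, and is antiparallel-free.
`compl_flow_sideWitness` (= registered `c1_sideWitness_aux8`) feeds this flow into `flow_sideWitness`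
(Aux5).  Parts 9/10 supply the supplementary systems: `2 × 2` tiles in the plane `(2,3)` for even `q`
(complement of an even box) and ladders in the plane `(a, 2)` for odd `q` (complement of an odd ball).
-/

namespace Summit.QuantumFields.QCD.Theorems.VonMisesCirclesC1

open Matrix Literature.MathematicalPhysics.QuantumLattice Literature.Probability.LatticeModels
open Summit.QuantumFields.QCD.Theorems.VonMisesCircles Literature.MathematicalPhysics.QuantumFieldTheory

set_option quotPrecheck false in
set_option hygiene false in
/-- The unit step `±e_μ` of label `ℓ = (μ, b)` on the torus of side `2S+1` (`STP`, to keep the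
generic-`N` name `STEP` of parts 3–5 free). -/
local notation "STP" ℓ:arg =>
  (if Prod.snd ℓ then -(Pi.single (Prod.fst ℓ) 1 : TorusSite 4 (2 * S + 1)) else Pi.single (Prod.fst ℓ) 1)

set_option quotPrecheck false in
set_option hygiene false in
/-- Offset coordinate `i` of the site `y` from the corner `c`, in `{0, …, 2S}`. -/
local notation "OFF" c:arg y:arg i:arg => (ZMod.val ((y : TorusSite 4 (2 * S + 1)) i - (c : TorusSite 4 (2 * S + 1)) i))

set_option quotPrecheck false in
/-- Out-label of the `2 × 2`-tile 4-cycle in the plane `(i, j)` at offsets of parities `(u, v)`. -/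
local notation "TL" i:arg j:arg u:arg v:arg =>
  (if u % 2 = 0 then (if v % 2 = 0 then ((i, false) : Fin 4 × Bool) else ((j, true) : Fin 4 × Bool))
    else (if v % 2 = 0 then ((j, false) : Fin 4 × Bool) else ((i, true) : Fin 4 × Bool)))

set_option quotPrecheck false in
/-- In-label of the `2 × 2`-tile 4-cycle in the plane `(i, j)` at offsets of parities `(u, v)`. -/
local notation "EL" i:arg j:arg u:arg v:arg =>
  (if u % 2 = 0 then (if v % 2 = 0 then ((j, true) : Fin 4 × Bool) else ((i, true) : Fin 4 × Bool))
    else (if v % 2 = 0 then ((i, false) : Fin 4 × Bool) else ((j, false) : Fin 4 × Bool)))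

set_option quotPrecheck false in
/-- The reversed label. -/
local notation "REV" ℓ:arg => ((Prod.fst ℓ, !(Prod.snd ℓ)) : Fin 4 × Bool)

set_option quotPrecheck false in
set_option hygiene false in
/-- Rule `R0`: the circle in direction `0` through `y` avoids the hole (a coordinate `1, 2, 3` is in `J`). -/
local notation "RZ" c:arg q:arg y:arg => (q ≤ OFF c y 1 ∨ q ≤ OFF c y 2 ∨ q ≤ OFF c y 3)

set_option quotPrecheck false in
set_option hygiene false in
/-- Rule `R1`: the circle in direction `1` through `y` avoids the hole (a coordinate `0, 2, 3` is in `J`). -/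
local notation "RO" c:arg q:arg y:arg => (q ≤ OFF c y 0 ∨ q ≤ OFF c y 2 ∨ q ≤ OFF c y 3)

/-- Rule `R0` is blind to coordinate `0`: it is invariant under the steps `±e₀`
(registered `c1_sideWitness_aux8`). -/
theorem rz_add_step_zero {S : ℕ} (c : TorusSite 4 (2 * S + 1)) (q : ℕ) (y : TorusSite 4 (2 * S + 1))
    (b : Bool) : RZ c q (y + STP ((0, b) : Fin 4 × Bool)) ↔ RZ c q y := by
  rw [off_add_step_of_ne c y ((0, b) : Fin 4 × Bool) (show (1 : Fin 4) ≠ 0 by decide),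
    off_add_step_of_ne c y ((0, b) : Fin 4 × Bool) (show (2 : Fin 4) ≠ 0 by decide),
    off_add_step_of_ne c y ((0, b) : Fin 4 × Bool) (show (3 : Fin 4) ≠ 0 by decide)]

/-- Rule `R1` is blind to coordinate `1`. -/
theorem ro_add_step_one {S : ℕ} (c : TorusSite 4 (2 * S + 1)) (q : ℕ) (y : TorusSite 4 (2 * S + 1))
    (b : Bool) : RO c q (y + STP ((1, b) : Fin 4 × Bool)) ↔ RO c q y := by
  rw [off_add_step_of_ne c y ((1, b) : Fin 4 × Bool) (show (0 : Fin 4) ≠ 1 by decide),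
    off_add_step_of_ne c y ((1, b) : Fin 4 × Bool) (show (2 : Fin 4) ≠ 1 by decide),
    off_add_step_of_ne c y ((1, b) : Fin 4 × Bool) (show (3 : Fin 4) ≠ 1 by decide)]

/-- **The flow on the complement of a corner box** (main result of this file). -/
theorem compl_flow_sideWitness {S : ℕ} (c : TorusSite 4 (2 * S + 1)) (q : ℕ) (m₀ : ℝ)
    (SL0 SEL0 SL1 SEL1 : TorusSite 4 (2 * S + 1) → Fin 4 × Bool)
    (hS0 : ∀ y : TorusSite 4 (2 * S + 1), q ≤ OFF c y 0 → OFF c y 1 < q → OFF c y 2 < q → OFF c y 3 < q →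
      ((∃ i : Fin 4, q ≤ OFF c (y + STP (SL0 y)) i) ∧ OFF c (y + STP (SL0 y)) 1 < q ∧
          OFF c (y + STP (SL0 y)) 2 < q ∧ OFF c (y + STP (SL0 y)) 3 < q ∧
          SEL0 (y + STP (SL0 y)) = SL0 y) ∧
        ((∃ i : Fin 4, q ≤ OFF c (y + STP (REV (SEL0 y))) i) ∧ OFF c (y + STP (REV (SEL0 y))) 1 < q ∧
          OFF c (y + STP (REV (SEL0 y))) 2 < q ∧ OFF c (y + STP (REV (SEL0 y))) 3 < q ∧
          SL0 (y + STP (REV (SEL0 y))) = SEL0 y) ∧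
        (SL0 y).1 ≠ 1 ∧ (SEL0 y).1 ≠ 1 ∧ SEL0 y ≠ REV (SL0 y))
    (hS1 : ∀ y : TorusSite 4 (2 * S + 1), q ≤ OFF c y 1 → OFF c y 0 < q → OFF c y 2 < q → OFF c y 3 < q →
      ((∃ i : Fin 4, q ≤ OFF c (y + STP (SL1 y)) i) ∧ OFF c (y + STP (SL1 y)) 0 < q ∧
          OFF c (y + STP (SL1 y)) 2 < q ∧ OFF c (y + STP (SL1 y)) 3 < q ∧
          SEL1 (y + STP (SL1 y)) = SL1 y) ∧
        ((∃ i : Fin 4, q ≤ OFF c (y + STP (REV (SEL1 y))) i) ∧ OFF c (y + STP (REV (SEL1 y))) 0 < q ∧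
          OFF c (y + STP (REV (SEL1 y))) 2 < q ∧ OFF c (y + STP (REV (SEL1 y))) 3 < q ∧
          SL1 (y + STP (REV (SEL1 y))) = SEL1 y) ∧
        (SL1 y).1 ≠ 0 ∧ (SEL1 y).1 ≠ 0 ∧ SEL1 y ≠ REV (SL1 y)) :
    ∃ U : GaugeConfig 4 (2 * S + 1) (Matrix.specialUnitaryGroup (Fin 3) ℂ),
      (sideMatrix (Finset.univ.filter fun y : TorusSite 4 (2 * S + 1) => ∃ i : Fin 4, q ≤ OFF c y i)
        (wilsonD U m₀)).det ≠ 0 := by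
  set A : Finset (TorusSite 4 (2 * S + 1)) :=
    Finset.univ.filter (fun y : TorusSite 4 (2 * S + 1) => ∃ i : Fin 4, q ≤ OFF c y i) with hAdef
  have hA : ∀ y, y ∈ A ↔ ∃ i : Fin 4, q ≤ OFF c y i := by
    intro y; simp [hAdef]
  -- steps in direction `0` / `1` do not change the other offsets
  have hinv0 : ∀ (y : TorusSite 4 (2 * S + 1)) (b : Bool) (k : Fin 4), k ≠ 0 →
      OFF c (y + STP ((0, b) : Fin 4 × Bool)) k = OFF c y k :=
    fun y b k hk => off_add_step_of_ne c y ((0, b) : Fin 4 × Bool) hk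
  have hinv1 : ∀ (y : TorusSite 4 (2 * S + 1)) (b : Bool) (k : Fin 4), k ≠ 1 →
      OFF c (y + STP ((1, b) : Fin 4 × Bool)) k = OFF c y k :=
    fun y b k hk => off_add_step_of_ne c y ((1, b) : Fin 4 × Bool) hk
  have hRZ : ∀ (y : TorusSite 4 (2 * S + 1)) (b : Bool), RZ c q (y + STP ((0, b) : Fin 4 × Bool)) ↔ RZ c q y :=
    fun y b => rz_add_step_zero c q y b
  have hRO : ∀ (y : TorusSite 4 (2 * S + 1)) (b : Bool), RO c q (y + STP ((1, b) : Fin 4 × Bool)) ↔ RO c q y :=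
    fun y b => ro_add_step_one c q y b
  have hmem0 : ∀ (y : TorusSite 4 (2 * S + 1)) (b : Bool), RZ c q y → (y + STP ((0, b) : Fin 4 × Bool)) ∈ A := by
    intro y b h
    rw [hA]
    rcases h with h | h | h
    · exact ⟨1, by rw [hinv0 y b 1 (by decide)]; exact h⟩
    · exact ⟨2, by rw [hinv0 y b 2 (by decide)]; exact h⟩
    · exact ⟨3, by rw [hinv0 y b 3 (by decide)]; exact h⟩
  have hmem1 : ∀ (y : TorusSite 4 (2 * S + 1)) (b : Bool), RO c q y → (y + STP ((1, b) : Fin 4 × Bool)) ∈ A := by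
    intro y b h
    rw [hA]
    rcases h with h | h | h
    · exact ⟨0, by rw [hinv1 y b 0 (by decide)]; exact h⟩
    · exact ⟨2, by rw [hinv1 y b 2 (by decide)]; exact h⟩
    · exact ⟨3, by rw [hinv1 y b 3 (by decide)]; exact h⟩
  -- the deficit classes
  have hcls0 : ∀ y ∈ A, ¬ RZ c q y → q ≤ OFF c y 0 ∧ OFF c y 1 < q ∧ OFF c y 2 < q ∧ OFF c y 3 < q := by
    intro y hy h
    rw [hA] at hy
    obtain ⟨i, hi⟩ := hy
    refine ⟨?_, by omega, by omega, by omega⟩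
    fin_cases i
    · exact hi
    · exact absurd (Or.inl hi) h
    · exact absurd (Or.inr (Or.inl hi)) h
    · exact absurd (Or.inr (Or.inr hi)) h
  have hcls1 : ∀ y ∈ A, ¬ RO c q y → q ≤ OFF c y 1 ∧ OFF c y 0 < q ∧ OFF c y 2 < q ∧ OFF c y 3 < q := by
    intro y hy h
    rw [hA] at hy
    obtain ⟨i, hi⟩ := hy
    refine ⟨?_, by omega, by omega, by omega⟩
    fin_cases i
    · exact absurd (Or.inl hi) h
    · exact hi
    · exact absurd (Or.inr (Or.inl hi)) h
    · exact absurd (Or.inr (Or.inr hi)) h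
  have hboth : ∀ y ∈ A, RZ c q y ∨ RO c q y := by
    intro y hy
    by_cases h0 : RZ c q y
    · exact Or.inl h0
    · by_cases h1 : RO c q y
      · exact Or.inr h1
      · exfalso
        have h0' := hcls0 y hy h0
        have h1' := hcls1 y hy h1
        omega
  -- the flow data
  set D : Fin 2 → TorusSite 4 (2 * S + 1) → Fin 4 × Bool := fun k y =>
    (![if RZ c q y then ((0, false) : Fin 4 × Bool) else SL0 y,
       if RO c q y then ((1, false) : Fin 4 × Bool) else SL1 y] : Fin 2 → Fin 4 × Bool) k with hDdef
  set E : Fin 2 → TorusSite 4 (2 * S + 1) → Fin 4 × Bool := fun k y =>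
    (![if RZ c q y then ((0, false) : Fin 4 × Bool) else SEL0 y,
       if RO c q y then ((1, false) : Fin 4 × Bool) else SEL1 y] : Fin 2 → Fin 4 × Bool) k with hEdef
  have hD0 : ∀ y, D 0 y = (if RZ c q y then ((0, false) : Fin 4 × Bool) else SL0 y) := fun y => rfl
  have hD1 : ∀ y, D 1 y = (if RO c q y then ((1, false) : Fin 4 × Bool) else SL1 y) := fun y => rfl
  have hE0 : ∀ y, E 0 y = (if RZ c q y then ((0, false) : Fin 4 × Bool) else SEL0 y) := fun y => rfl
  have hE1 : ∀ y, E 1 y = (if RO c q y then ((1, false) : Fin 4 × Bool) else SEL1 y) := fun y => rfl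
  refine flow_sideWitness A m₀ (fun k y => y + STP (D k y)) (fun k y => y + STP (REV (E k y))) D E
    ?_ ?_ ?_ ?_ ?_ ?_
  · -- hσ
    intro y hy k
    refine ⟨?_, rfl⟩
    fin_cases k
    · show y + STP (D 0 y) ∈ A
      rw [hD0]
      by_cases h : RZ c q y
      · rw [if_pos h]; exact hmem0 y false h
      · rw [if_neg h]
        obtain ⟨h0, h1, h2, h3⟩ := hcls0 y hy h
        rw [hA]; exact (hS0 y h0 h1 h2 h3).1.1
    · show y + STP (D 1 y) ∈ A
      rw [hD1]
      by_cases h : RO c q y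
      · rw [if_pos h]; exact hmem1 y false h
      · rw [if_neg h]
        obtain ⟨h1, h0, h2, h3⟩ := hcls1 y hy h
        rw [hA]; exact (hS1 y h1 h0 h2 h3).1.1
  · -- hd
    intro y hy h
    rw [hD0, hD1] at h
    by_cases h0 : RZ c q y <;> by_cases h1 : RO c q y
    · rw [if_pos h0, if_pos h1] at h; exact absurd (congrArg Prod.fst h) (by decide)
    · rw [if_pos h0, if_neg h1] at h
      obtain ⟨hh1, hh0, hh2, hh3⟩ := hcls1 y hy h1
      exact (hS1 y hh1 hh0 hh2 hh3).2.2.1 (congrArg Prod.fst h).symm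
    · rw [if_neg h0, if_pos h1] at h
      obtain ⟨hh0, hh1, hh2, hh3⟩ := hcls0 y hy h0
      exact (hS0 y hh0 hh1 hh2 hh3).2.2.1 (congrArg Prod.fst h)
    · exact absurd (hboth y hy) (by tauto)
  · -- hπ
    intro y hy k
    refine ⟨?_, rfl, k, ?_⟩
    · fin_cases k
      · show y + STP (REV (E 0 y)) ∈ A
        rw [hE0]
        by_cases h : RZ c q y
        · rw [if_pos h]; exact hmem0 y true h
        · rw [if_neg h]
          obtain ⟨h0, h1, h2, h3⟩ := hcls0 y hy h
          rw [hA]; exact (hS0 y h0 h1 h2 h3).2.1.1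
      · show y + STP (REV (E 1 y)) ∈ A
        rw [hE1]
        by_cases h : RO c q y
        · rw [if_pos h]; exact hmem1 y true h
        · rw [if_neg h]
          obtain ⟨h1, h0, h2, h3⟩ := hcls1 y hy h
          rw [hA]; exact (hS1 y h1 h0 h2 h3).2.1.1
    · fin_cases k
      · show D 0 (y + STP (REV (E 0 y))) = E 0 y
        rw [hE0, hD0]
        by_cases h : RZ c q y
        · rw [if_pos h]
          have h' : RZ c q (y + STP (REV ((0, false) : Fin 4 × Bool))) := (hRZ y true).2 h
          rw [if_pos h']
        · rw [if_neg h]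
          obtain ⟨h0, h1, h2, h3⟩ := hcls0 y hy h
          obtain ⟨-, ⟨-, hp1, hp2, hp3, hp⟩, -⟩ := hS0 y h0 h1 h2 h3
          rw [if_neg (show ¬ RZ c q (y + STP (REV (SEL0 y))) from by omega), hp]
      · show D 1 (y + STP (REV (E 1 y))) = E 1 y
        rw [hE1, hD1]
        by_cases h : RO c q y
        · rw [if_pos h]
          have h' : RO c q (y + STP (REV ((1, false) : Fin 4 × Bool))) := (hRO y true).2 h
          rw [if_pos h']
        · rw [if_neg h]
          obtain ⟨h1, h0, h2, h3⟩ := hcls1 y hy h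
          obtain ⟨-, ⟨-, hp0, hp2, hp3, hp⟩, -⟩ := hS1 y h1 h0 h2 h3
          rw [if_neg (show ¬ RO c q (y + STP (REV (SEL1 y))) from by omega), hp]
  · -- he
    intro y hy h
    rw [hE0, hE1] at h
    by_cases h0 : RZ c q y <;> by_cases h1 : RO c q y
    · rw [if_pos h0, if_pos h1] at h; exact absurd (congrArg Prod.fst h) (by decide)
    · rw [if_pos h0, if_neg h1] at h
      obtain ⟨hh1, hh0, hh2, hh3⟩ := hcls1 y hy h1
      exact (hS1 y hh1 hh0 hh2 hh3).2.2.2.1 (congrArg Prod.fst h).symm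
    · rw [if_neg h0, if_pos h1] at h
      obtain ⟨hh0, hh1, hh2, hh3⟩ := hcls0 y hy h0
      exact (hS0 y hh0 hh1 hh2 hh3).2.2.2.1 (congrArg Prod.fst h)
    · exact absurd (hboth y hy) (by tauto)
  · -- hin
    intro y hy k
    refine ⟨k, ?_, ?_⟩
    · fin_cases k
      · show y + STP (D 0 y) + STP (REV (E 0 (y + STP (D 0 y)))) = y
        rw [hE0, hD0]
        by_cases h : RZ c q y
        · rw [if_pos h]
          have h' : RZ c q (y + STP ((0, false) : Fin 4 × Bool)) := (hRZ y false).2 h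
          rw [if_pos h', add_assoc, step_add_step_rev, add_zero]
        · rw [if_neg h]
          obtain ⟨h0, h1, h2, h3⟩ := hcls0 y hy h
          obtain ⟨⟨-, hz1, hz2, hz3, hz⟩, -, -⟩ := hS0 y h0 h1 h2 h3
          rw [if_neg (show ¬ RZ c q (y + STP (SL0 y)) from by omega), hz, add_assoc, step_add_step_rev, add_zero]
      · show y + STP (D 1 y) + STP (REV (E 1 (y + STP (D 1 y)))) = y
        rw [hE1, hD1]
        by_cases h : RO c q y
        · rw [if_pos h]
          have h' : RO c q (y + STP ((1, false) : Fin 4 × Bool)) := (hRO y false).2 h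
          rw [if_pos h', add_assoc, step_add_step_rev, add_zero]
        · rw [if_neg h]
          obtain ⟨h1, h0, h2, h3⟩ := hcls1 y hy h
          obtain ⟨⟨-, hz0, hz2, hz3, hz⟩, -, -⟩ := hS1 y h1 h0 h2 h3
          rw [if_neg (show ¬ RO c q (y + STP (SL1 y)) from by omega), hz, add_assoc, step_add_step_rev, add_zero]
    · fin_cases k
      · show E 0 (y + STP (D 0 y)) = D 0 y
        rw [hE0, hD0]
        by_cases h : RZ c q y
        · rw [if_pos h]
          have h' : RZ c q (y + STP ((0, false) : Fin 4 × Bool)) := (hRZ y false).2 h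
          rw [if_pos h']
        · rw [if_neg h]
          obtain ⟨h0, h1, h2, h3⟩ := hcls0 y hy h
          obtain ⟨⟨-, hz1, hz2, hz3, hz⟩, -, -⟩ := hS0 y h0 h1 h2 h3
          rw [if_neg (show ¬ RZ c q (y + STP (SL0 y)) from by omega), hz]
      · show E 1 (y + STP (D 1 y)) = D 1 y
        rw [hE1, hD1]
        by_cases h : RO c q y
        · rw [if_pos h]
          have h' : RO c q (y + STP ((1, false) : Fin 4 × Bool)) := (hRO y false).2 h
          rw [if_pos h']
        · rw [if_neg h]
          obtain ⟨h1, h0, h2, h3⟩ := hcls1 y hy h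
          obtain ⟨⟨-, hz0, hz2, hz3, hz⟩, -, -⟩ := hS1 y h1 h0 h2 h3
          rw [if_neg (show ¬ RO c q (y + STP (SL1 y)) from by omega), hz]
  · -- hanti
    intro y hy k k' h
    fin_cases k <;> fin_cases k'
    · change E 0 y = REV (D 0 y) at h
      rw [hE0, hD0] at h
      by_cases h0 : RZ c q y
      · rw [if_pos h0, if_pos h0] at h; exact absurd (congrArg Prod.snd h) (by decide)
      · rw [if_neg h0, if_neg h0] at h
        obtain ⟨hh0, hh1, hh2, hh3⟩ := hcls0 y hy h0
        exact (hS0 y hh0 hh1 hh2 hh3).2.2.2.2 h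
    · change E 1 y = REV (D 0 y) at h
      rw [hE1, hD0] at h
      by_cases h0 : RZ c q y <;> by_cases h1 : RO c q y
      · rw [if_pos h0, if_pos h1] at h; exact absurd (congrArg Prod.fst h) (by decide)
      · rw [if_pos h0, if_neg h1] at h
        obtain ⟨hh1, hh0, hh2, hh3⟩ := hcls1 y hy h1
        exact (hS1 y hh1 hh0 hh2 hh3).2.2.2.1 (congrArg Prod.fst h)
      · rw [if_neg h0, if_pos h1] at h
        obtain ⟨hh0, hh1, hh2, hh3⟩ := hcls0 y hy h0
        exact (hS0 y hh0 hh1 hh2 hh3).2.2.1 (congrArg Prod.fst h).symm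
      · exact absurd (hboth y hy) (by tauto)
    · change E 0 y = REV (D 1 y) at h
      rw [hE0, hD1] at h
      by_cases h0 : RZ c q y <;> by_cases h1 : RO c q y
      · rw [if_pos h0, if_pos h1] at h; exact absurd (congrArg Prod.fst h) (by decide)
      · rw [if_pos h0, if_neg h1] at h
        obtain ⟨hh1, hh0, hh2, hh3⟩ := hcls1 y hy h1
        exact (hS1 y hh1 hh0 hh2 hh3).2.2.1 (congrArg Prod.fst h).symm
      · rw [if_neg h0, if_pos h1] at h
        obtain ⟨hh0, hh1, hh2, hh3⟩ := hcls0 y hy h0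
        exact (hS0 y hh0 hh1 hh2 hh3).2.2.2.1 (congrArg Prod.fst h)
      · exact absurd (hboth y hy) (by tauto)
    · change E 1 y = REV (D 1 y) at h
      rw [hE1, hD1] at h
      by_cases h1 : RO c q y
      · rw [if_pos h1, if_pos h1] at h; exact absurd (congrArg Prod.snd h) (by decide)
      · rw [if_neg h1, if_neg h1] at h
        obtain ⟨hh1, hh0, hh2, hh3⟩ := hcls1 y hy h1
        exact (hS1 y hh1 hh0 hh2 hh3).2.2.2.2 h

/-- **Registered helper `c1_sideWitness_aux8` of crux stmt-QuantumFields-11512** (line `von-mises-circles`,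
sub-goal `c1_sideWitness`): rule `R0` of the complement flow is blind to coordinate `0` (the file's main
result is `compl_flow_sideWitness`). -/
theorem c1_sideWitness_aux8 : ∀ (S : ℕ) (c : TorusSite 4 (2 * S + 1)) (q : ℕ) (y : TorusSite 4 (2 * S + 1)) (b : Bool), (q ≤ (ZMod.val (((y + (if Prod.snd ((0, b) : Fin 4 × Bool) then -(Pi.single (Prod.fst ((0, b) : Fin 4 × Bool)) 1 : TorusSite 4 (2 * S + 1)) else Pi.single (Prod.fst ((0, b) : Fin 4 × Bool)) 1)) : TorusSite 4 (2 * S + 1)) 1 - (c : TorusSite 4 (2 * S + 1)) 1)) ∨ q ≤ (ZMod.val (((y + (if Prod.snd ((0, b) : Fin 4 × Bool) then -(Pi.single (Prod.fst ((0, b) : Fin 4 × Bool)) 1 : TorusSite 4 (2 * S + 1)) else Pi.single (Prod.fst ((0, b) : Fin 4 × Bool)) 1)) : TorusSite 4 (2 * S + 1)) 2 - (c : TorusSite 4 (2 * S + 1)) 2)) ∨ q ≤ (ZMod.val (((y + (if Prod.snd ((0, b) : Fin 4 × Bool) then -(Pi.single (Prod.fst ((0, b) : Fin 4 × Bool)) 1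 : TorusSite 4 (2 * S + 1)) else Pi.single (Prod.fst ((0, b) : Fin 4 × Bool)) 1)) : TorusSite 4 (2 * S + 1)) 3 - (c : TorusSite 4 (2 * S + 1)) 3))) ↔ (q ≤ (ZMod.val ((y : TorusSite 4 (2 * S + 1)) 1 - (c : TorusSite 4 (2 * S + 1)) 1)) ∨ q ≤ (ZMod.val ((y : TorusSite 4 (2 * S + 1)) 2 - (c : TorusSite 4 (2 * S + 1)) 2)) ∨ q ≤ (ZMod.val ((y : TorusSite 4 (2 * S + 1)) 3 - (c : TorusSite 4 (2 * S + 1)) 3))) :=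
  fun _ c q y b => rz_add_step_zero c q y b

end Summit.QuantumFields.QCD.Theorems.VonMisesCirclesC1
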